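import Mathlib
import Literature.Barriers.ValiantsHypothesis.PartialDerivativesDetPerm
import Literature.Computability.AlgebraicComplexity.BLMW11WeakValiantHypothesis
import Summits.ValiantsHypothesis.ValiantsHypothesis.Theorems.GrenetZeonTwoDimCoefficientsDefs
import Summits.ValiantsHypothesis.ValiantsHypothesis.Theorems.GrenetZeonTwoDimCoefficientsTraceChainHessian
import Summits.ValiantsHypothesis.ValiantsHypothesis.Theorems.GrenetZeonTwoDimCoefficientsDualUnipotentConstrainedPencil

/-!
# Crux `GrenetZeon.TwoDimCoefficients` (stmt-ValiantsHypothesis-8062), stub `stub_dualUnipotent`: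
# the COMMUTATIVE RUNG — commuting nilpotent pencils carrying `per_n` have exponential width

The open stub `DualUnipotentBound` reads, in pencil currency (✓ `dualUnipotentBound_iff_constrainedPencil`):
if `per_n = tr(N^{n−1}·M)` with `N`, `M` `m × m` matrices of LINEAR forms (`N^m = 0`, trace constraints), then
`n² ≤ C·m`.  The record (`…DualUnipotentFlat`, `…DualUnipotentTriangular`) is `m ≥ √2·n` for all pencils and
`m ≳ n^{3/2}` for TRIANGULARISABLE ones; on the COMMUTATIVE locus (the coefficient matrices `N_c = [x_c]N`
pairwise commute — a commuting family is triangularisable) nothing better than `n^{3/2}` was on record.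

This file shows that on the commutative locus HIGHER-ORDER FLATTENINGS DO close the stub, with an exponential
margin.  If the `N_c` commute, the `k`-th order partial derivatives of `tr(N^{j}·M)` collapse:

  `∂_{c_1}⋯∂_{c_k} tr(N^{j}·M) = (j)_k · tr(N_{c_1}⋯N_{c_k} · N^{j−k} · M) + Σ_t (j)_{k−1} · tr(∏_{s≠t} N_{c_s} · N^{j−k+1} · M_{c_t})`,

so the span of ALL `k`-th order partials lies in the span `V_k` of the `(n² + 1)·m²` ENTRIES of the matrices
`N^{j−k} · M` and `N^{j+1−k} · M_d` (`d` a variable) — one derivative maps `V_k` into `V_{k+1}` by the power rule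
`∂_c N^i = i·N_c·N^{i−1}` (`finrank_span_derivSet_trace_pow_mul_le`); while the `k`-th flattening of `per_n`
has rank `C(n,k)²` (tree ✓ `Literature.Barriers.ValiantsHypothesis.flatteningRank_perPoly`, Landsberg 2017
Exercise 6.2.2.7).  Hence

* `choose_sq_le_of_commutative_pencil` — ★ `C(n,k)² ≤ (n² + 1)·m²` for every `k`
  (no nilpotency and no trace constraints are used; `M` is an arbitrary matrix of linear forms);
* `four_pow_le_of_commutative_pencil` — `4^n ≤ (n + 1)²·(n² + 1)·m²` (central binomial coefficient);
* `sq_le_of_commutative_pencil` — the stub's shape on the commutative locus: `n² ≤ 17·m` (`n ≥ 4`, from `k = 3`);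
* `dualUnipotentBound_commutative` — the statement `DualUnipotentBound` with the pencil hypothesis of
  ✓ `dualUnipotentBound_iff_constrainedPencil` augmented by commutativity, `C = 17`, `n₀ = 4`;
* `sq_le_of_commutative_resolvent` — the same in resolvent currency `per_n = tr((1 − N)⁻¹·M)`
  (✓ `dualUnipotentBound_iff_resolvent`).

This is the apolarity mechanism (`f = λ(ℓ(x)^d)` over a commutative algebra `A` forces `dim A ≥` the Hilbert
function of `f` — Iarrobino–Kanev; here `A ⊆ M_m(ℂ)`), typed for this model; commutative representations of `per_n`
exist (regular representation of a truncated polynomial ring), so the locus is not empty.  WHAT IT SAYS ABOUT THE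
STUB: a sub-quadratic unipotent-dual representation of `per_n` must use a genuinely NON-COMMUTATIVE pencil.

HONEST FRAMING: a sub-case rung (def-free helper, `--supports stmt-ValiantsHypothesis-8062`); the registered stub
`stub_dualUnipotent`, the crux (an ASIDE item), 24318 and `VP ≠ VNP` are NOT proved by anything here.

References: J. M. Landsberg, *Geometry and Complexity Theory* (CUP 2017), §6.2.2, Exercise 6.2.2.7; A. Iarrobino,
V. Kanev, *Power Sums, Gorenstein Algebras, and Determinantal Loci*, LNM 1721 (1999), Ch. 1 (apolarity).
-/

-- single-conjunct layout: the duplicated namespace component is mandated by the tree.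
set_option linter.dupNamespace false

noncomputable section

namespace Summit.ValiantsHypothesis.ValiantsHypothesis.Cruxes.TwoDimCoefficients.DimTwoCases

open MvPolynomial Matrix
open Literature.Computability.AlgebraicComplexity
open Literature.Barriers.ValiantsHypothesis (iterPDeriv derivSet shiftedPartialsRank_zero_eq
  flatteningRank_perPoly iterPDeriv_nil iterPDeriv_cons)

namespace CommutativePencil

variable {σ : Type} {ι : Type}

/-! ### Matrix calculus: trace, powers of a pencil with a commuting derivative -/

/-- The entrywise derivative of the identity matrix vanishes. [folklore] -/
theorem map_pderiv_one [DecidableEq ι] (c : σ) : (1 : Matrix ι ι (MvPolynomial σ ℂ)).map (pderiv c) = 0 := by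
  refine Matrix.ext fun i j => ?_
  rw [Matrix.map_apply, Matrix.one_apply, Matrix.zero_apply]
  split_ifs
  · exact pderiv_one
  · exact map_zero _

/-- Power rule when the derivative `D = ∂_c N` commutes with `N`: `∂_c N^{j+1} = (j+1)·D·N^j`. [folklore] -/
theorem map_pderiv_pow_succ [Fintype ι] [DecidableEq ι] (c : σ) (N D : Matrix ι ι (MvPolynomial σ ℂ))
    (hD : N.map (pderiv c) = D) (hcomm : Commute D N) (j : ℕ) :
    (N ^ (j + 1)).map (pderiv c) = (j + 1) • (D * N ^ j) := by
  induction j with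
  | zero => rw [zero_add, pow_one, hD, pow_zero, Matrix.mul_one, one_smul]
  | succ j ih =>
    rw [pow_succ N (j + 1), TraceChain.map_pderiv_mul, ih, hD, smul_mul_assoc, Matrix.mul_assoc,
      ← pow_succ, ← (hcomm.pow_right (j + 1)).eq, succ_nsmul (D * N ^ (j + 1)) (j + 1)]

/-- Power rule, all exponents: `∂_c N^j = j·D·N^{j−1}` (`j = 0`: both sides vanish). [folklore] -/
theorem map_pderiv_pow [Fintype ι] [DecidableEq ι] (c : σ) (N D : Matrix ι ι (MvPolynomial σ ℂ))
    (hD : N.map (pderiv c) = D) (hcomm : Commute D N) (j : ℕ) :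
    (N ^ j).map (pderiv c) = j • (D * N ^ (j - 1)) := by
  cases j with
  | zero => rw [pow_zero, zero_smul, map_pderiv_one]
  | succ j => rw [map_pderiv_pow_succ c N D hD hcomm j, Nat.add_sub_cancel]

/-! ### The engine: flattenings of `tr(N^j · M)` lie in the span of the entries of the shapes -/

/-- ★ ENGINE.  Let `N`, `M` be polynomial matrices whose entrywise partial derivatives `∂_c N = N_c`,
`∂_c M = M_c` are CONSTANT matrices, with every `N_c` commuting with `N` (e.g. a linear pencil with pairwise
commuting coefficients, and any matrix of linear forms `M`).  Then for every `j`, `k` the `k`-th order partial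
derivatives of `tr(N^j · M)` span a space of dimension `≤ (#σ + 1)·(#ι)²`: by the power rule
`∂_c N^i = i·N_c·N^{i−1}` (commutation), one derivative maps the span `V_k` of the ENTRIES of the shapes
`N^{j−k}·M` and `N^{j+1−k}·M_d` (`d ∈ σ`) into `V_{k+1}`, and `tr(N^j·M) ∈ V_0`; `V_k` has `(#σ + 1)·(#ι)²`
generators. [folklore] -/
theorem finrank_span_derivSet_trace_pow_mul_le [Fintype σ] [DecidableEq σ] [Fintype ι] [DecidableEq ι]
    {N M : Matrix ι ι (MvPolynomial σ ℂ)} {Nc Mc : σ → Matrix ι ι ℂ}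
    (hN : ∀ c, N.map (pderiv c) = (Nc c).map C) (hM : ∀ c, M.map (pderiv c) = (Mc c).map C)
    (hcomm : ∀ c, Commute ((Nc c).map (C : ℂ → MvPolynomial σ ℂ)) N) (j k : ℕ) :
    Module.finrank ℂ (Submodule.span ℂ (derivSet k (N ^ j * M).trace)) ≤
      (Fintype.card σ + 1) * Fintype.card ι ^ 2 := by
  /- (1) generators of `V_k`: the entries of `N^{j-k}·M` (index `none`) and of `N^{j+1-k}·M_d` (index `some d`) -/
  obtain ⟨g, g_none, g_some⟩ : ∃ g : ℕ → Option σ × ι × ι → MvPolynomial σ ℂ,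
      (∀ k a b, g k (none, a, b) = (N ^ (j - k) * M) a b) ∧
      (∀ k d a b, g k (some d, a, b) = (N ^ (j + 1 - k) * (Mc d).map (C : ℂ → MvPolynomial σ ℂ)) a b) :=
    ⟨fun k p => p.1.elim ((N ^ (j - k) * M) p.2.1 p.2.2)
        fun d => (N ^ (j + 1 - k) * (Mc d).map (C : ℂ → MvPolynomial σ ℂ)) p.2.1 p.2.2,
      fun _ _ _ => rfl, fun _ _ _ _ => rfl⟩
  /- (2) left multiplication by a CONSTANT matrix preserves «all entries of a column lie in V» -/
  have hrow : ∀ (k : ℕ) (K : Matrix ι ι ℂ) (P : Matrix ι ι (MvPolynomial σ ℂ)) (a b : ι),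
      (∀ x, P x b ∈ Submodule.span ℂ (Set.range (g k))) →
      (K.map (C : ℂ → MvPolynomial σ ℂ) * P) a b ∈ Submodule.span ℂ (Set.range (g k)) := by
    intro k K P a b hP
    rw [Matrix.mul_apply]
    refine Submodule.sum_mem _ fun x _ => ?_
    rw [Matrix.map_apply, ← smul_eq_C_mul]
    exact Submodule.smul_mem _ _ (hP x)
  /- (3) one derivative `∂_c` maps every generator of `V_k` into `V_{k+1}` -/
  have hgen : ∀ (k : ℕ) (c : σ) (p : Option σ × ι × ι),
      pderiv c (g k p) ∈ Submodule.span ℂ (Set.range (g (k + 1))) := by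
    rintro k c ⟨o, a, b⟩
    cases o with
    | none =>
      -- `∂_c (N^{j-k} M)_{ab} = (j-k)·(N_c N^{j-k-1} M)_{ab} + (N^{j-k} M_c)_{ab}`
      rw [g_none]
      change ((N ^ (j - k) * M).map (pderiv c)) a b ∈ _
      rw [TraceChain.map_pderiv_mul, map_pderiv_pow c N _ (hN c) (hcomm c), hM c, Matrix.add_apply]
      refine Submodule.add_mem _ ?_ ?_
      · rw [smul_mul_assoc, Matrix.smul_apply, Matrix.mul_assoc]
        refine nsmul_mem (hrow (k + 1) (Nc c) (N ^ (j - k - 1) * M) a b fun x => ?_) _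
        exact Submodule.subset_span ⟨(none, x, b), by rw [g_none, Nat.sub_add_eq]⟩
      · exact Submodule.subset_span ⟨(some c, a, b), by rw [g_some, Nat.add_sub_add_right]⟩
    | some d =>
      -- `∂_c (N^{j+1-k} M_d)_{ab} = (j+1-k)·(N_c N^{j-k} M_d)_{ab}`
      rw [g_some]
      change ((N ^ (j + 1 - k) * (Mc d).map (C : ℂ → MvPolynomial σ ℂ)).map (pderiv c)) a b ∈ _
      rw [TraceChain.map_pderiv_mul, map_pderiv_pow c N _ (hN c) (hcomm c), TraceChain.map_pderiv_map_C,
        Matrix.mul_zero, add_zero, smul_mul_assoc, Matrix.smul_apply, Matrix.mul_assoc]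
      refine nsmul_mem (hrow (k + 1) (Nc c) (N ^ (j + 1 - k - 1) * (Mc d).map (C : ℂ → MvPolynomial σ ℂ)) a b
        fun x => ?_) _
      have hexp : j + 1 - k - 1 = j + 1 - (k + 1) := by omega
      exact Submodule.subset_span ⟨(some d, x, b), by rw [g_some, hexp]⟩
  /- (4) hence `∂_c V_k ⊆ V_{k+1}` -/
  have hV : ∀ (k : ℕ) (c : σ), ∀ x ∈ Submodule.span ℂ (Set.range (g k)),
      pderiv c x ∈ Submodule.span ℂ (Set.range (g (k + 1))) := by
    intro k c x hx
    induction hx using Submodule.span_induction with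
    | mem x hx =>
      obtain ⟨p, rfl⟩ := hx
      exact hgen k c p
    | zero =>
      rw [map_zero]
      exact Submodule.zero_mem _
    | add x y _ _ hx hy =>
      rw [map_add]
      exact Submodule.add_mem _ hx hy
    | smul a x _ hx =>
      rw [Derivation.map_smul]
      exact Submodule.smul_mem _ _ hx
  /- (5) iterate: `k` derivatives map `V_0` into `V_k` -/
  have hiter : ∀ (l : List σ), ∀ x ∈ Submodule.span ℂ (Set.range (g 0)),
      iterPDeriv l x ∈ Submodule.span ℂ (Set.range (g l.length)) := by
    intro l
    induction l with
    | nil =>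
      intro x hx
      simpa only [iterPDeriv_nil, List.length_nil] using hx
    | cons c l ih =>
      intro x hx
      rw [iterPDeriv_cons, List.length_cons]
      exact hV _ c _ (ih x hx)
  /- (6) `tr(N^j · M) ∈ V_0` -/
  have hbase : (N ^ j * M).trace ∈ Submodule.span ℂ (Set.range (g 0)) := by
    rw [Matrix.trace]
    refine Submodule.sum_mem _ fun a _ => Submodule.subset_span ⟨(none, a, a), ?_⟩
    rw [g_none, Nat.sub_zero, Matrix.diag_apply]
  /- (7) count generators -/
  have hspan : Submodule.span ℂ (derivSet k (N ^ j * M).trace) ≤ Submodule.span ℂ (Set.range (g k)) := by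
    rw [Submodule.span_le]
    rintro _ ⟨l, hl, rfl⟩
    have h := hiter l _ hbase
    rw [hl] at h
    exact h
  haveI : Module.Finite ℂ (Submodule.span ℂ (Set.range (g k))) :=
    Module.Finite.span_of_finite ℂ (Set.finite_range _)
  calc Module.finrank ℂ (Submodule.span ℂ (derivSet k (N ^ j * M).trace))
      ≤ Module.finrank ℂ (Submodule.span ℂ (Set.range (g k))) := Submodule.finrank_mono hspan
    _ ≤ Fintype.card (Option σ × ι × ι) := finrank_range_le_card (g k)
    _ = (Fintype.card σ + 1) * Fintype.card ι ^ 2 := by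
        rw [Fintype.card_prod, Fintype.card_prod, Fintype.card_option, pow_two]

/-! ### Linear pencils: `∂_c N = [x_c]N`, and commuting coefficients commute with the pencil -/

/-- For a LINEAR form `p` (homogeneous of degree `1`), `∂_c p` is the constant `[x_c] p`. [folklore] -/
theorem pderiv_eq_C_coeff_of_isHomogeneous_one [Fintype σ] [DecidableEq σ] {p : MvPolynomial σ ℂ}
    (hp : p.IsHomogeneous 1) (c : σ) : pderiv c p = C (coeff (Finsupp.single c 1) p) := by
  have h0 : coeff 0 p = 0 := hp.coeff_eq_zero (by simp)
  have hp' := eq_C_add_sum_smul_X_of_totalDegree_le_one hp.totalDegree_le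
  rw [h0, C_0, zero_add] at hp'
  conv_lhs => rw [hp']
  rw [map_sum, Finset.sum_eq_single c]
  · rw [Derivation.map_smul, pderiv_X, Pi.single_eq_same, smul_eq_C_mul, mul_one]
  · intro t _ htc
    rw [Derivation.map_smul, pderiv_X, Pi.single_eq_of_ne htc, smul_zero]
  · intro h
    exact absurd (Finset.mem_univ c) h

/-- A linear form is the sum of the variables times its coefficients. [folklore] -/
theorem eq_sum_X_mul_C_coeff_of_isHomogeneous_one [Fintype σ] [DecidableEq σ] {p : MvPolynomial σ ℂ}
    (hp : p.IsHomogeneous 1) : p = ∑ t : σ, X t * C (coeff (Finsupp.single t 1) p) := by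
  have h0 : coeff 0 p = 0 := hp.coeff_eq_zero (by simp)
  have hp' := eq_C_add_sum_smul_X_of_totalDegree_le_one hp.totalDegree_le
  rw [h0, C_0, zero_add] at hp'
  conv_lhs => rw [hp']
  exact Finset.sum_congr rfl fun t _ => by rw [smul_eq_C_mul, mul_comm]

/-- The matrix of `∂_c` of a LINEAR pencil is the constant coefficient matrix `[x_c]N`. [folklore] -/
theorem map_pderiv_of_linear [Fintype σ] [DecidableEq σ] {N : Matrix ι ι (MvPolynomial σ ℂ)}
    (hN : ∀ i j, (N i j).IsHomogeneous 1) (c : σ) :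
    N.map (pderiv c) = (N.map fun p => coeff (Finsupp.single c 1) p).map C :=
  Matrix.ext fun i j => by
    simp only [Matrix.map_apply]
    exact pderiv_eq_C_coeff_of_isHomogeneous_one (hN i j) c

/-- A linear pencil is `Σ_t x_t · [x_t]N`. [folklore] -/
theorem eq_sum_X_smul_coeff_of_linear [Fintype σ] [DecidableEq σ] {N : Matrix ι ι (MvPolynomial σ ℂ)}
    (hN : ∀ i j, (N i j).IsHomogeneous 1) :
    N = ∑ t : σ, (X t : MvPolynomial σ ℂ) • (N.map fun p => coeff (Finsupp.single t 1) p).map C :=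
  Matrix.ext fun i j => by
    rw [Matrix.sum_apply]
    simp only [Matrix.smul_apply, Matrix.map_apply, smul_eq_mul]
    exact eq_sum_X_mul_C_coeff_of_isHomogeneous_one (hN i j)

/-- If the coefficient matrices of a linear pencil pairwise commute, each of them commutes with the pencil.
[folklore] -/
theorem commute_coeff_of_linear [Fintype σ] [DecidableEq σ] [Fintype ι] [DecidableEq ι]
    {N : Matrix ι ι (MvPolynomial σ ℂ)} (hN : ∀ i j, (N i j).IsHomogeneous 1)
    (hcomm : ∀ c d : σ,
      (N.map fun p => coeff (Finsupp.single c 1) p) * (N.map fun p => coeff (Finsupp.single d 1) p) =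
        (N.map fun p => coeff (Finsupp.single d 1) p) * (N.map fun p => coeff (Finsupp.single c 1) p))
    (c : σ) :
    Commute ((N.map fun p => coeff (Finsupp.single c 1) p).map (C : ℂ → MvPolynomial σ ℂ)) N := by
  have key : Commute ((N.map fun p => coeff (Finsupp.single c 1) p).map (C : ℂ → MvPolynomial σ ℂ))
      (∑ t : σ, (X t : MvPolynomial σ ℂ) • (N.map fun p => coeff (Finsupp.single t 1) p).map C) := by
    refine Commute.sum_right _ _ _ fun t _ => Commute.smul_right ?_ _
    have h1 : Commute (N.map fun p => coeff (Finsupp.single c 1) p)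
        (N.map fun p => coeff (Finsupp.single t 1) p) := hcomm c t
    have h2 := h1.map (C : ℂ →+* MvPolynomial σ ℂ).mapMatrix
    simpa only [RingHom.mapMatrix_apply] using h2
  rwa [← eq_sum_X_smul_coeff_of_linear hN] at key

end CommutativePencil

open CommutativePencil

/-! ### ★ The commutative rung -/

variable {n m : ℕ}

/-- ★ **COMMUTATIVE RUNG (flattening form).**  If `per_n = tr(N^{n−1}·M)` with `N`, `M` `m × m` matrices of
linear forms and the coefficient matrices `[x_c]N` of the pencil pairwise COMMUTE, then for every order `k`

  `C(n,k)² ≤ (n² + 1)·m²`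

— the `k`-th order partials of `per_n` (spanning `C(n,k)²` dimensions, Landsberg 2017 Exercise 6.2.2.7, tree
✓ `flatteningRank_perPoly`) lie in the span of the `(n² + 1)·m²` entries of `N^{n−1−k}·M`, `N^{n−k}·[x_d]M`.
Neither nilpotency of `N` nor the trace constraints of the stub's model are needed.
[cite: LandsbergGCT2017, Exercise 6.2.2.7 (p. 159)] -/
theorem choose_sq_le_of_commutative_pencil (N M : AffMat n m) (hN : ∀ i j, (N i j).IsHomogeneous 1)
    (hM : ∀ i j, (M i j).IsHomogeneous 1)
    (hcomm : ∀ c d : Fin n × Fin n,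
      (N.map fun p => coeff (Finsupp.single c 1) p) * (N.map fun p => coeff (Finsupp.single d 1) p) =
        (N.map fun p => coeff (Finsupp.single d 1) p) * (N.map fun p => coeff (Finsupp.single c 1) p))
    (hper : perPoly (Fin n) ℂ = (N ^ (n - 1) * M).trace) (k : ℕ) :
    (n.choose k) ^ 2 ≤ (n ^ 2 + 1) * m ^ 2 := by
  have h1 := flatteningRank_perPoly ℂ n k
  rw [shiftedPartialsRank_zero_eq, hper] at h1
  have h2 := finrank_span_derivSet_trace_pow_mul_le (map_pderiv_of_linear hN) (map_pderiv_of_linear hM)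
    (commute_coeff_of_linear hN hcomm) (n - 1) k
  rw [h1, Fintype.card_prod, Fintype.card_fin, Fintype.card_fin, ← pow_two] at h2
  exact h2

/-- **Exponential form**: under the same hypotheses `4^n ≤ (n + 1)²·(n² + 1)·m²` (the central binomial
coefficient is at least `2^n/(n+1)`). [folklore] -/
theorem four_pow_le_of_commutative_pencil (N M : AffMat n m) (hN : ∀ i j, (N i j).IsHomogeneous 1)
    (hM : ∀ i j, (M i j).IsHomogeneous 1)
    (hcomm : ∀ c d : Fin n × Fin n,
      (N.map fun p => coeff (Finsupp.single c 1) p) * (N.map fun p => coeff (Finsupp.single d 1) p) =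
        (N.map fun p => coeff (Finsupp.single d 1) p) * (N.map fun p => coeff (Finsupp.single c 1) p))
    (hper : perPoly (Fin n) ℂ = (N ^ (n - 1) * M).trace) :
    4 ^ n ≤ (n + 1) ^ 2 * ((n ^ 2 + 1) * m ^ 2) := by
  have hk := choose_sq_le_of_commutative_pencil N M hN hM hcomm hper (n / 2)
  -- `2^n = Σ_k C(n,k) ≤ (n+1)·C(n, n/2)`
  have h2 : 2 ^ n ≤ (n + 1) * n.choose (n / 2) := by
    rw [← Nat.sum_range_choose n]
    calc ∑ i ∈ Finset.range (n + 1), n.choose i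
        ≤ ∑ _i ∈ Finset.range (n + 1), n.choose (n / 2) :=
          Finset.sum_le_sum fun i _ => Nat.choose_le_middle i n
      _ = (n + 1) * n.choose (n / 2) := by rw [Finset.sum_const, Finset.card_range, smul_eq_mul]
  have h4 : (4 : ℕ) ^ n = (2 ^ n) ^ 2 := by
    rw [← pow_mul, mul_comm, pow_mul]
    norm_num
  calc 4 ^ n = (2 ^ n) ^ 2 := h4
    _ ≤ ((n + 1) * n.choose (n / 2)) ^ 2 := Nat.pow_le_pow_left h2 2
    _ = (n + 1) ^ 2 * (n.choose (n / 2)) ^ 2 := by ring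
    _ ≤ (n + 1) ^ 2 * ((n ^ 2 + 1) * m ^ 2) := Nat.mul_le_mul_left _ hk

/-- Arithmetic of the third flattening: `C(n,3)² ≤ (n²+1)·m²` forces `n² ≤ 17·m` once `n ≥ 4`. [folklore] -/
theorem sq_le_seventeen_mul_of_choose_three {n m : ℕ} (hn : 4 ≤ n) (h : (n.choose 3) ^ 2 ≤ (n ^ 2 + 1) * m ^ 2) :
    n ^ 2 ≤ 17 * m := by
  obtain ⟨t, rfl⟩ : ∃ t, n = t + 4 := ⟨n - 4, by omega⟩
  -- `6·C(n,3) = n(n-1)(n-2)`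
  have h6 : 6 * (t + 4).choose 3 = (t + 4) * (t + 3) * (t + 2) := by
    have hd := Nat.descFactorial_eq_factorial_mul_choose (t + 4) 3
    rw [show Nat.factorial 3 = 6 from rfl] at hd
    have e1 : t + 4 - 2 = t + 2 := by omega
    have e2 : t + 4 - 1 = t + 3 := by omega
    rw [← hd, Nat.descFactorial_succ, Nat.descFactorial_succ, Nat.descFactorial_succ, Nat.descFactorial_zero,
      e1, e2, Nat.sub_zero]
    ring
  -- polynomial domination: `36 (n²+1) n⁴ ≤ 289 (n(n-1)(n-2))²` for `n ≥ 4` (all coefficients in `t = n - 4` are ≥ 0)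
  have hdom : 36 * ((t + 4) ^ 2 + 1) * (t + 4) ^ 4 ≤ 289 * ((t + 4) * (t + 3) * (t + 2)) ^ 2 := by
    have hid : 289 * ((t + 4) * (t + 3) * (t + 2)) ^ 2 = 36 * ((t + 4) ^ 2 + 1) * (t + 4) ^ 4 +
        (9792 + 130272 * t + 178516 * t ^ 2 + 102468 * t ^ 3 + 29761 * t ^ 4 + 4338 * t ^ 5 +
          253 * t ^ 6) := by
      ring
    rw [hid]
    exact Nat.le_add_right _ _
  -- combine and cancel `36 (n² + 1) > 0`
  have hsq : ((t + 4) ^ 2) ^ 2 ≤ (17 * m) ^ 2 := by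
    have hpos : 0 < 36 * ((t + 4) ^ 2 + 1) := by positivity
    have key : 36 * ((t + 4) ^ 2 + 1) * ((t + 4) ^ 2) ^ 2 ≤ 36 * ((t + 4) ^ 2 + 1) * (17 * m) ^ 2 := by
      calc 36 * ((t + 4) ^ 2 + 1) * ((t + 4) ^ 2) ^ 2
          = 36 * ((t + 4) ^ 2 + 1) * (t + 4) ^ 4 := by ring
        _ ≤ 289 * ((t + 4) * (t + 3) * (t + 2)) ^ 2 := hdom
        _ = 289 * (6 * (t + 4).choose 3) ^ 2 := by rw [h6]
        _ = 289 * 36 * ((t + 4).choose 3) ^ 2 := by ring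
        _ ≤ 289 * 36 * (((t + 4) ^ 2 + 1) * m ^ 2) := Nat.mul_le_mul_left _ h
        _ = 36 * ((t + 4) ^ 2 + 1) * (17 * m) ^ 2 := by ring
    exact Nat.le_of_mul_le_mul_left key hpos
  exact (Nat.pow_le_pow_iff_left (by norm_num : (2 : ℕ) ≠ 0)).1 hsq

/-- ★ **COMMUTATIVE RUNG (the stub's shape).**  If `per_n = tr(N^{n−1}·M)` (`n ≥ 4`) with `N`, `M` `m × m`
matrices of linear forms and pairwise commuting coefficient matrices `[x_c]N`, then `n² ≤ 17·m`.  (Record for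
general pencils: `m ≥ √2·n`; for triangularisable — in particular commutative — ones: `m ≳ n^{3/2}`.) [folklore] -/
theorem sq_le_of_commutative_pencil (hn : 4 ≤ n) (N M : AffMat n m) (hN : ∀ i j, (N i j).IsHomogeneous 1)
    (hM : ∀ i j, (M i j).IsHomogeneous 1)
    (hcomm : ∀ c d : Fin n × Fin n,
      (N.map fun p => coeff (Finsupp.single c 1) p) * (N.map fun p => coeff (Finsupp.single d 1) p) =
        (N.map fun p => coeff (Finsupp.single d 1) p) * (N.map fun p => coeff (Finsupp.single c 1) p))
    (hper : perPoly (Fin n) ℂ = (N ^ (n - 1) * M).trace) : n ^ 2 ≤ 17 * m :=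
  sq_le_seventeen_mul_of_choose_three hn (choose_sq_le_of_commutative_pencil N M hN hM hcomm hper 3)

/-- ★ **`DualUnipotentBound` ON THE COMMUTATIVE LOCUS** — the right-hand side of
✓ `dualUnipotentBound_iff_constrainedPencil` (the stub verbatim in pencil currency) with the one extra conjunct
«the coefficient matrices of `N` pairwise commute», proved with `C = 17`, `n₀ = 4`.  (The conjuncts `N^m = 0` and
the trace constraints are not used.)  The open core of `stub_dualUnipotent` is thereby the NON-COMMUTATIVE pencil.
[folklore] -/
theorem dualUnipotentBound_commutative :
    ∃ C n₀ : ℕ, ∀ n ≥ n₀, ∀ m : ℕ,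
      (∃ N M : AffMat n m, (∀ i j, (N i j).IsHomogeneous 1) ∧ (∀ i j, (M i j).IsHomogeneous 1) ∧
        (∀ c d : Fin n × Fin n,
          (N.map fun p => coeff (Finsupp.single c 1) p) * (N.map fun p => coeff (Finsupp.single d 1) p) =
            (N.map fun p => coeff (Finsupp.single d 1) p) * (N.map fun p => coeff (Finsupp.single c 1) p)) ∧
        N ^ m = 0 ∧ perPoly (Fin n) ℂ = (N ^ (n - 1) * M).trace ∧
        ∀ j : ℕ, j ≠ n - 1 → (N ^ j * M).trace = 0) → n ^ 2 ≤ C * m := by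
  refine ⟨17, 4, fun n hn m h => ?_⟩
  obtain ⟨N, M, hN, hM, hcomm, -, hper, -⟩ := h
  exact sq_le_of_commutative_pencil hn N M hN hM hcomm hper

/-- ★ **COMMUTATIVE RUNG, resolvent currency** (✓ `dualUnipotentBound_iff_resolvent`): if
`per_n = tr((1 − N)⁻¹·M)` (`n ≥ 4`) with `N`, `M` `m × m` matrices of linear forms, `N^m = 0`, and pairwise
commuting coefficient matrices `[x_c]N`, then `n² ≤ 17·m` — via the homogeneous component
`per_n = tr(N^{n−1}·M)` (✓ `trace_inv_one_sub_mul`, ✓ `trace_pow_mul_eq_of_sum_eq`, ✓ `sum_trace_pow_mul_eq`).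
[folklore] -/
theorem sq_le_of_commutative_resolvent (hn : 4 ≤ n) (N M : AffMat n m) (hN : ∀ i j, (N i j).IsHomogeneous 1)
    (hM : ∀ i j, (M i j).IsHomogeneous 1) (hnil : N ^ m = 0)
    (hcomm : ∀ c d : Fin n × Fin n,
      (N.map fun p => coeff (Finsupp.single c 1) p) * (N.map fun p => coeff (Finsupp.single d 1) p) =
        (N.map fun p => coeff (Finsupp.single d 1) p) * (N.map fun p => coeff (Finsupp.single c 1) p))
    (hres : perPoly (Fin n) ℂ = ((1 - N)⁻¹ * M).trace) : n ^ 2 ≤ 17 * m := by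
  rw [trace_inv_one_sub_mul N M hnil] at hres
  have hcon : ∀ j < m, j ≠ n - 1 → (N ^ j * M).trace = 0 := fun j hj hjn => by
    rw [trace_pow_mul_eq_of_sum_eq N M hN hM hres hj, if_neg (by omega)]
  have hper : perPoly (Fin n) ℂ = (N ^ (n - 1) * M).trace := by
    rw [hres, sum_trace_pow_mul_eq N M hnil hcon]
  exact sq_le_of_commutative_pencil hn N M hN hM hcomm hper

end Summit.ValiantsHypothesis.ValiantsHypothesis.Cruxes.TwoDimCoefficients.DimTwoCases

end
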